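import Summits.BirchSwinnertonDyer.Rank1Residual.Partition.TamagawaHeegnerAnyPrime
import Summits.BirchSwinnertonDyer.Rank1Residual.Partition.MainConjecturesIrreducibleThree
import HarnessLib

/-!
# Row C16 (`p = 3`, Yan–Zhu 2026) at MAIN-CONJECTURE level, one level BELOW STEP L, and the generic
# odd-prime class theorem: anticyclotomic main conjecture + control AS TYPED ON THE CONSTRUCTED
# `X_ac` + Yan–Zhu's cyclotomic main conjecture (named fact) + cited control ⇒ BSD(E,3)
# (cell `b2b-bsdres`, GLUE seat gen 3; companion of `Partition/MainConjecturesAnticyclotomicGoodClass.lean`)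

HONEST FRAMING (cell `b2b-bsdres`, run/shared/lean/b2b/bsd-rank1-residual/, verbatim in every
file): the goal of the cell is to DELETE the COMBINATION-SHAPED residual classes of the
Birch–Swinnerton-Dyer formula for ALL analytic-rank `≤ 1` elliptic curves over `ℚ` — "full BSD
formula for every rank `≤ 1` curve in class `C`" assembled STRICTLY from published theorems — so
that the rank-`≤ 1` remainder becomes exactly the CONSTRUCTION-SHAPED classes, which are TYPED
(missing-input `Prop`s), NOT attempted. This is not "finishing BSD". Research routes; no claim
beyond the stated classes; nothing booked; no label changes. THEOREMS ONLY (no definition, no named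
fact, no `sorry`); every published theorem enters as one of the tree's existing named Literature
facts BY NAME; every unproved / untyped-in-Literature statement enters as an EXPLICIT binder.

## What this file records

`Partition/MainConjecturesAnticyclotomicGoodClass.lean` replaced gen 2's OUTPUT-level binder `hL`
(STEP L = `X11b.IndexLowerBoundAt`) by the two good-`p` anticyclotomic links on the constructed `X_ac`
((CTL)ᵍ `X11b.ControlOnTreeGoodAt`, (IMC≥∘BDP)ᵍ `X11b.IMCLowerWaldspurgerOnTreeGoodAt`) for `p ≥ 5`
(rows C2, C3-ord), the bound coming from multr1's Tamagawa transports. With the `p`-free Tamagawa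
identities of `Partition/TamagawaHeegnerAnyPrime.lean` (JSW17 (eq:tamK) as an identity of natural
numbers at a classical Heegner field) the same replacement is made here for EVERY odd prime, in
particular `p = 3` = row C16 (Yan–Zhu, J. Algebra 693 (2026), Thm. 4.15; its printed `r = 1` route:
Thm. 4.12 = BDP main conjecture + Heegner point main conjecture for the classical `X₀(N)`
parametrisation over `K` with `p` split, + BDP formula + anticyclotomic control + Thm. 4.9 for the
twist):

| theorem | locus | typed inputs | replaces (gen 2) |
|---|---|---|---|
| `bsdp_rankOne_of_onTreeGoodLinks_of_columnMainConjecture_odd` | `p ≥ 3` good ordinary, surj, `r = 1`, `p ∤ ∏c_ℓ` | `hMC` (column MC at `p`), `hIm`, `hLC`, `hLA` | `…_of_indexLowerBoundAt_of_columnMainConjecture` (`p ≥ 3`) and gen 3's `…_of_onTreeGoodLinks_…` (`p ≥ 5`) |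
| `RowC16.bsdp_rankOne_of_onTreeGoodLinks_of_yzThm49` | row C16, `r = 1`, `3 ∤ ∏c_ℓ` | `hLC`, `hLA` (class-quantified) + Yan–Zhu Thm. 4.9 (named fact) + Wuthrich L20 | `RowC16.bsdp_rankOne_of_indexLowerBoundAt_of_yzThm49` |
| `RowC16.bsdp_of_yzThm49_of_onTreeGoodLinks` | row C16, `r ≤ 1` | same | `RowC16.bsdp_of_yzThm49_of_indexLowerBoundAt` |

So after this file EVERY covered non-CM rank-one row of RESIDUAL-CASES §a.1 at a good ordinary prime
— C2 (`p > 3`), C3-ordinary (`p ≥ 5`), C16 (`p = 3`), on `p ∤ ∏_ℓ c_ℓ` — reads in the kernel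
"(anticyclotomic main conjecture, as typed on `X_ac`) + (anticyclotomic control, as typed on `X_ac`) +
(cyclotomic main conjecture of the twist: a PUBLISHED named fact, as typed) + (control / Gross–Zagier /
Kolyvagin / Manin / field: named facts) ⇒ `BSD(E,p)`", with NO output-level binder.

References: [YanZhu2024MainConjNonCM] Thm. 4.9, 4.12, 4.15 (§4.4–4.6; J. Algebra 693 (2026) =
arXiv:2412.20078v4); [BurungaleCastellaSkinner2025] Cor. 1.3.1 (proof); [Castella2018] Thm. 2.3, 3.2;
[JetchevSkinnerWan2017] Thm. 3.3.1, §7.3.1 (eq:tamK), §7.4.1; [Wuthrich2014] Lemma 20;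
[GreenbergLNM1716] Thm. 4.1; [HoffsteinLuo1997]; [Mazur1978] Cor. 4.1; [Miller2011LMS] Def. 1.1;
HOME/b2b-bsdres-lit-glue/GLUE.md §G2.4 (A4), GEN 3 addendum.
-/

set_option autoImplicit false

noncomputable section

open scoped Classical

open WeierstrassCurve NumberField IsDedekindDomain Literature.NumberTheory.EllipticCurves
  Literature.NumberTheory.EllipticCurves.ModularForms
  Literature.NumberTheory.EllipticCurves.Rank1Residual
  Literature.NumberTheory.EllipticCurves.YanZhu2026
  Summit.BirchSwinnertonDyer.BirchSwinnertonDyer.Theorems.Rank1ResidualX1Defs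

namespace Summit.BirchSwinnertonDyer.Rank1Residual

/-! ### The generic odd-prime class theorem, one level below STEP L -/

/-- **Rank one at the class level, generic in the ODD prime `p ≥ 3`, from the column's typed
cyclotomic main conjecture and the two GOOD-`p` ANTICYCLOTOMIC LINKS ON THE CONSTRUCTED `X_ac`.**
Gen 2's `bsdp_rankOne_of_indexLowerBoundAt_of_columnMainConjecture` with its OUTPUT-level binder `hL`
REPLACED by `hLC` = (CTL)ᵍ (Cas18 Thm. 2.3, `ε_p = p⁻¹` ⇐ JSW17 Thm. 3.3.1 — PUBLISHED shape) and
`hLA` = (IMC≥∘BDP)ᵍ (BCS 2025 Thm. 1.2.4 (`p > 3`) / Yan–Zhu 2026 Thm. 4.12 (`p` odd) ∘ Cas18 Thm. 3.2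
— PUBLISHED shape on these data), demanded for THIS pair at every Manin-unit classical Heegner datum
over a field with `d_K` odd `< −4`, every `ℓ ∣ N` split, `p` split, `L(E^{d_K},1) ≠ 0`, at the
non-torsion Heegner point, for every anticyclotomic `κ`, generator `γ`, degree-one `𝔭 ∋ p`, with THE
embedding `embAt K p 𝔭`. STEP L at each datum is
`X11b.indexLowerBoundAt_of_heegner_of_onTreeGoodInputs_anyPrime` (the `p`-free Tamagawa identities);
then gen 2. Supersedes gen 3's `bsdp_rankOne_of_onTreeGoodLinks_of_columnMainConjecture` (`p ≥ 5`).
[cite: YanZhu2024MainConjNonCM, Thm. 4.15 (proof, §4.6), Thm. 4.12, Thm. 4.9]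
[cite: BurungaleCastellaSkinner2025, Cor. 1.3.1 (r = 1) and its proof (p. 4); Thm. 1.2.4]
[cite: Castella2018, Thm. 2.3 (p. 5), Thm. 3.2 (p. 9)] [cite: JetchevSkinnerWan2017, Thm. 3.3.1, §7.4.1 (pp. 11, 30)]
[cite: Miller2011LMS, Def. 1.1] -/
theorem bsdp_rankOne_of_onTreeGoodLinks_of_columnMainConjecture_odd
    -- published inputs (named facts of the tree)
    (hGZ : ∀ (N : ℕ) [NeZero N] (W : WeierstrassCurve ℚ) (K : Type) [Field K] [NumberField K],
      gross_zagier N W K)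
    (hKo : ∀ (N : ℕ) [NeZero N] (W : WeierstrassCurve ℚ) (K : Type) [Field K] [NumberField K],
      kolyvagin N W K)
    (hB : ∀ (N : ℕ) [NeZero N] (W : WeierstrassCurve ℚ) (K : Type) [Field K] [NumberField K],
      Kolyvagin1990_padicValNat_card_sha_le N W K)
    (hGr : greenberg_charValue_rankZero) (hGZK : rank_eq_analyticRank_of_analyticRank_le_one)
    (hmod : hasEntireLFunction_rat) (hpar : nonempty_modularParametrizationData)
    (hnf : exists_isNewformOf) (hHL : HoffsteinLuo1997_exists_twist_L_one_ne_zero)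
    (hMaz : mazur_not_dvd_maninConstant_of_odd) (hNS : integral_neronScaling_of_isGloballyMinimal)
    -- the pair
    (W : WeierstrassCurve ℚ) [W.IsElliptic] [W.IsGloballyMinimal] (p : ℕ) [Fact p.Prime]
    (hp3 : 3 ≤ p) (hord : GoodOrd W p) (hsurj : Surj W p) (hr : W.analyticRank = 1)
    (htam0 : ¬ p ∣ W.tamagawaProduct)
    -- the column's typed cyclotomic main conjecture at `p`, and the (im)-from-surj witness at `p`
    (hMC : ∀ (V : WeierstrassCurve ℚ) [V.IsElliptic] [V.IsGloballyMinimal],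
      GoodOrd V p → Irr V p → BigIm V p → MazurMainConjecture V p)
    (hIm : ∀ (V : WeierstrassCurve ℚ) [V.IsElliptic] [V.IsGloballyMinimal],
      GoodOrd V p → Surj V p → BigIm V p)
    -- (CTL)ᵍ on the constructed `X_ac` at every classical Heegner datum of this pair — PUBLISHED shape
    (hLC : ∀ (N : ℕ) [NeZero N] (K : Type) [Field K] [NumberField K]
      (Dt : ModularParametrizationData W N) (H : HeegnerDatum N (NumberField.discr K)) (ι : K →+* ℂ)
      (P : (W.baseChange K).toAffine.Point),
      W.conductorNorm ℤ = N → IsImaginaryQuadratic K → Odd (NumberField.discr K) →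
      NumberField.discr K < -4 → SatisfiesHeegnerHypothesis N K → SatisfiesHeegnerHypothesis p K →
      (W.quadraticTwist (NumberField.discr K : ℚ)).entireLFunction 1 ≠ 0 →
      WeierstrassCurve.Affine.Point.map ι.toRatAlgHom P = heegnerPointComplex Dt H →
      ¬ (p : ℤ) ∣ Dt.c → ¬ IsOfFinAddOrder P →
      ∀ (κ : ZpExtension K p), κ.IsAnticyclotomic →
        ∀ (γ : Field.absoluteGaloisGroup K) [Fact (κ.IsTopGenerator γ)]
          (𝔭 : HeightOneSpectrum (𝓞 K)) (h𝔭 : ((p : ℕ) : 𝓞 K) ∈ 𝔭.asIdeal)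
          (he : 𝔭.asIdeal.ramificationIdx (𝓞 ℚ) = 1) (hf : 𝔭.asIdeal.inertiaDeg (𝓞 ℚ) = 1),
          X11b.ControlOnTreeGoodAt p κ 𝔭 γ (X11b.embAt K p 𝔭 h𝔭 he hf) P)
    -- (IMC≥∘BDP)ᵍ on the constructed `X_ac` at the same data — PUBLISHED shape
    (hLA : ∀ (N : ℕ) [NeZero N] (K : Type) [Field K] [NumberField K]
      (Dt : ModularParametrizationData W N) (H : HeegnerDatum N (NumberField.discr K)) (ι : K →+* ℂ)
      (P : (W.baseChange K).toAffine.Point),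
      W.conductorNorm ℤ = N → IsImaginaryQuadratic K → Odd (NumberField.discr K) →
      NumberField.discr K < -4 → SatisfiesHeegnerHypothesis N K → SatisfiesHeegnerHypothesis p K →
      (W.quadraticTwist (NumberField.discr K : ℚ)).entireLFunction 1 ≠ 0 →
      WeierstrassCurve.Affine.Point.map ι.toRatAlgHom P = heegnerPointComplex Dt H →
      ¬ (p : ℤ) ∣ Dt.c → ¬ IsOfFinAddOrder P →
      ∀ (κ : ZpExtension K p), κ.IsAnticyclotomic →
        ∀ (γ : Field.absoluteGaloisGroup K) [Fact (κ.IsTopGenerator γ)]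
          (𝔭 : HeightOneSpectrum (𝓞 K)) (h𝔭 : ((p : ℕ) : 𝓞 K) ∈ 𝔭.asIdeal)
          (he : 𝔭.asIdeal.ramificationIdx (𝓞 ℚ) = 1) (hf : 𝔭.asIdeal.inertiaDeg (𝓞 ℚ) = 1),
          X11b.IMCLowerWaldspurgerOnTreeGoodAt p κ 𝔭 γ (X11b.embAt K p 𝔭 h𝔭 he hf) P) :
    BSDp W p :=
  bsdp_rankOne_of_indexLowerBoundAt_of_columnMainConjecture hGZ hKo hB hGr hGZK hmod hpar hnf hHL hMaz
    hNS W p hp3 hord hsurj hr htam0 hMC hIm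
    (fun N _ K _ _ Dt H ι P hN hK hodd hlt hHN hHp hLt hP hc ↦
      have hPinf : ¬ IsOfFinAddOrder P :=
        X11b.not_isOfFinAddOrder_of_heegner_of_analyticRank_eq_one W N K Dt H ι P (hGZ N W K) hmod
          hr hK hHN hLt hP
      X11b.indexLowerBoundAt_of_heegner_of_onTreeGoodInputs_anyPrime W p N K Dt H ι P (hGZ N W K)
        (hKo N W K) hmod hr hN hK hHN hHp hLt hP
        (fun κ hκ γ _ 𝔭 h𝔭 he hf ↦
          hLC N K Dt H ι P hN hK hodd hlt hHN hHp hLt hP hc hPinf κ hκ γ 𝔭 h𝔭 he hf)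
        (fun κ hκ γ _ 𝔭 h𝔭 he hf ↦
          hLA N K Dt H ι P hN hK hodd hlt hHN hHp hLt hP hc hPinf κ hκ γ 𝔭 h𝔭 he hf))

/-! ### Row C16 (`p = 3`, Yan–Zhu 2026) -/

/-- **C16 ∩ {r = 1}, `3 ∤ ∏ c_ℓ`, along its PRINTED route one level below STEP L** (Yan–Zhu 2026
Thm. 4.15, proof §4.6: Thm. 4.12 (BDP / Heegner point anticyclotomic main conjectures at `p = 3` for
the classical parametrisation) + BDP formula + anticyclotomic control + Thm. 4.9 for the twist): the
two good-`p` anticyclotomic links as typed on `X_ac` (`hLC`, `hLA`, class-quantified over row C16's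
pairs and the admissible data) + Yan–Zhu Thm. 4.9 (named fact `hYZ`) + Wuthrich 2014 Lemma 20 (`hW20`:
(Im) at `3` from surj(3) + good reduction, `X9.bigIm_three_of_surj`) + cited control ⇒ `BSD(E,3)`.
Replaces gen 2's `RowC16.bsdp_rankOne_of_indexLowerBoundAt_of_yzThm49` (binder `hL` = the output).
[cite: YanZhu2024MainConjNonCM, Thm. 4.15 (proof, §4.6), Thm. 4.12, Thm. 4.9]
[cite: Wuthrich2014, Lemma 20 (p. 399)] [cite: Castella2018, Thm. 2.3, Thm. 3.2] [cite: Miller2011LMS, Def. 1.1] -/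
theorem RowC16.bsdp_rankOne_of_onTreeGoodLinks_of_yzThm49
    (hGZ : ∀ (N : ℕ) [NeZero N] (W : WeierstrassCurve ℚ) (K : Type) [Field K] [NumberField K],
      gross_zagier N W K)
    (hKo : ∀ (N : ℕ) [NeZero N] (W : WeierstrassCurve ℚ) (K : Type) [Field K] [NumberField K],
      kolyvagin N W K)
    (hB : ∀ (N : ℕ) [NeZero N] (W : WeierstrassCurve ℚ) (K : Type) [Field K] [NumberField K],
      Kolyvagin1990_padicValNat_card_sha_le N W K)
    (hYZ : thm49_charIdeal_eq_padicLFunction_integral)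
    (hW20 : Wuthrich2014.lemma20_surjective_threeAdic_of_semistable)
    (hGr : greenberg_charValue_rankZero) (hGZK : rank_eq_analyticRank_of_analyticRank_le_one)
    (hmod : hasEntireLFunction_rat) (hpar : nonempty_modularParametrizationData)
    (hnf : exists_isNewformOf) (hHL : HoffsteinLuo1997_exists_twist_L_one_ne_zero)
    (hMaz : mazur_not_dvd_maninConstant_of_odd) (hNS : integral_neronScaling_of_isGloballyMinimal)
    (hLC : ∀ (W : WeierstrassCurve ℚ) [W.IsElliptic] [W.IsGloballyMinimal] (p : ℕ) [Fact p.Prime]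
      (N : ℕ) [NeZero N] (K : Type) [Field K] [NumberField K]
      (Dt : ModularParametrizationData W N) (H : HeegnerDatum N (NumberField.discr K)) (ι : K →+* ℂ)
      (P : (W.baseChange K).toAffine.Point),
      RowC16 W p → W.analyticRank = 1 → ¬ p ∣ W.tamagawaProduct →
      W.conductorNorm ℤ = N → IsImaginaryQuadratic K → Odd (NumberField.discr K) →
      NumberField.discr K < -4 → SatisfiesHeegnerHypothesis N K → SatisfiesHeegnerHypothesis p K →
      (W.quadraticTwist (NumberField.discr K : ℚ)).entireLFunction 1 ≠ 0 →
      WeierstrassCurve.Affine.Point.map ι.toRatAlgHom P = heegnerPointComplex Dt H →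
      ¬ (p : ℤ) ∣ Dt.c → ¬ IsOfFinAddOrder P →
      ∀ (κ : ZpExtension K p), κ.IsAnticyclotomic →
        ∀ (γ : Field.absoluteGaloisGroup K) [Fact (κ.IsTopGenerator γ)]
          (𝔭 : HeightOneSpectrum (𝓞 K)) (h𝔭 : ((p : ℕ) : 𝓞 K) ∈ 𝔭.asIdeal)
          (he : 𝔭.asIdeal.ramificationIdx (𝓞 ℚ) = 1) (hf : 𝔭.asIdeal.inertiaDeg (𝓞 ℚ) = 1),
          X11b.ControlOnTreeGoodAt p κ 𝔭 γ (X11b.embAt K p 𝔭 h𝔭 he hf) P)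
    (hLA : ∀ (W : WeierstrassCurve ℚ) [W.IsElliptic] [W.IsGloballyMinimal] (p : ℕ) [Fact p.Prime]
      (N : ℕ) [NeZero N] (K : Type) [Field K] [NumberField K]
      (Dt : ModularParametrizationData W N) (H : HeegnerDatum N (NumberField.discr K)) (ι : K →+* ℂ)
      (P : (W.baseChange K).toAffine.Point),
      RowC16 W p → W.analyticRank = 1 → ¬ p ∣ W.tamagawaProduct →
      W.conductorNorm ℤ = N → IsImaginaryQuadratic K → Odd (NumberField.discr K) →
      NumberField.discr K < -4 → SatisfiesHeegnerHypothesis N K → SatisfiesHeegnerHypothesis p K →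
      (W.quadraticTwist (NumberField.discr K : ℚ)).entireLFunction 1 ≠ 0 →
      WeierstrassCurve.Affine.Point.map ι.toRatAlgHom P = heegnerPointComplex Dt H →
      ¬ (p : ℤ) ∣ Dt.c → ¬ IsOfFinAddOrder P →
      ∀ (κ : ZpExtension K p), κ.IsAnticyclotomic →
        ∀ (γ : Field.absoluteGaloisGroup K) [Fact (κ.IsTopGenerator γ)]
          (𝔭 : HeightOneSpectrum (𝓞 K)) (h𝔭 : ((p : ℕ) : 𝓞 K) ∈ 𝔭.asIdeal)
          (he : 𝔭.asIdeal.ramificationIdx (𝓞 ℚ) = 1) (hf : 𝔭.asIdeal.inertiaDeg (𝓞 ℚ) = 1),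
          X11b.IMCLowerWaldspurgerOnTreeGoodAt p κ 𝔭 γ (X11b.embAt K p 𝔭 h𝔭 he hf) P)
    (W : WeierstrassCurve ℚ) [W.IsElliptic] [W.IsGloballyMinimal] (p : ℕ) [Fact p.Prime]
    (h : RowC16 W p) (hr1 : W.analyticRank = 1) (htam0 : ¬ p ∣ W.tamagawaProduct) : BSDp W p := by
  obtain ⟨hp3, hord, hirr, hsr⟩ := h
  have hsurj : Surj W p := by
    rcases hsr with hs | hram
    · exact hs
    · exact surj_of_irr_of_ram W p hirr hram
  subst hp3
  exact bsdp_rankOne_of_onTreeGoodLinks_of_columnMainConjecture_odd hGZ hKo hB hGr hGZK hmod hpar hnf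
    hHL hMaz hNS W 3 le_rfl hord hsurj hr1 htam0
    (fun V _ _ hordV hirrV himV ↦ hYZ V 3 le_rfl hordV hirrV himV)
    (fun V _ _ hordV hsV ↦ X9.bigIm_three_of_surj V hW20 (Or.inl hordV.1) hsV)
    (fun N _ K _ _ Dt H ι P hN hK hodd hlt hHN hHp hLt hP hc hPinf ↦
      hLC W 3 N K Dt H ι P ⟨rfl, hord, hirr, hsr⟩ hr1 htam0 hN hK hodd hlt hHN hHp hLt hP hc hPinf)
    (fun N _ K _ _ Dt H ι P hN hK hodd hlt hHN hHp hLt hP hc hPinf ↦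
      hLA W 3 N K Dt H ι P ⟨rfl, hord, hirr, hsr⟩ hr1 htam0 hN hK hodd hlt hHN hHp hLt hP hc hPinf)

/-- **Row C16 (`r ≤ 1`) entirely at "typed cyclotomic main conjecture (PUBLISHED: Yan–Zhu Thm. 4.9)
+ typed ANTICYCLOTOMIC main conjecture and control ON THE CONSTRUCTED `X_ac` (PUBLISHED: Yan–Zhu
Thm. 4.12, Cas18 Thm. 2.3 / JSW17 Thm. 3.3.1) + cited control"**: `r = 0` by
`RowC16.bsdp_rankZero_of_yzThm49` (gen 2); `r = 1` (with `3 ∤ ∏c_ℓ`, where STEP L and Kolyvagin's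
bound meet) by `RowC16.bsdp_rankOne_of_onTreeGoodLinks_of_yzThm49`. Replaces gen 2's
`RowC16.bsdp_of_yzThm49_of_indexLowerBoundAt`. [cite: YanZhu2024MainConjNonCM, Thm. 4.15 and its proof (§4.6)]
[cite: Miller2011LMS, Def. 1.1] -/
theorem RowC16.bsdp_of_yzThm49_of_onTreeGoodLinks
    (hGZ : ∀ (N : ℕ) [NeZero N] (W : WeierstrassCurve ℚ) (K : Type) [Field K] [NumberField K],
      gross_zagier N W K)
    (hKo : ∀ (N : ℕ) [NeZero N] (W : WeierstrassCurve ℚ) (K : Type) [Field K] [NumberField K],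
      kolyvagin N W K)
    (hB : ∀ (N : ℕ) [NeZero N] (W : WeierstrassCurve ℚ) (K : Type) [Field K] [NumberField K],
      Kolyvagin1990_padicValNat_card_sha_le N W K)
    (hYZ : thm49_charIdeal_eq_padicLFunction_integral)
    (hW20 : Wuthrich2014.lemma20_surjective_threeAdic_of_semistable)
    (hGr : greenberg_charValue_rankZero) (hGZK : rank_eq_analyticRank_of_analyticRank_le_one)
    (hmod : hasEntireLFunction_rat) (hpar : nonempty_modularParametrizationData)
    (hnf : exists_isNewformOf) (hHL : HoffsteinLuo1997_exists_twist_L_one_ne_zero)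
    (hMaz : mazur_not_dvd_maninConstant_of_odd) (hNS : integral_neronScaling_of_isGloballyMinimal)
    (hLC : ∀ (W : WeierstrassCurve ℚ) [W.IsElliptic] [W.IsGloballyMinimal] (p : ℕ) [Fact p.Prime]
      (N : ℕ) [NeZero N] (K : Type) [Field K] [NumberField K]
      (Dt : ModularParametrizationData W N) (H : HeegnerDatum N (NumberField.discr K)) (ι : K →+* ℂ)
      (P : (W.baseChange K).toAffine.Point),
      RowC16 W p → W.analyticRank = 1 → ¬ p ∣ W.tamagawaProduct →
      W.conductorNorm ℤ = N → IsImaginaryQuadratic K → Odd (NumberField.discr K) →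
      NumberField.discr K < -4 → SatisfiesHeegnerHypothesis N K → SatisfiesHeegnerHypothesis p K →
      (W.quadraticTwist (NumberField.discr K : ℚ)).entireLFunction 1 ≠ 0 →
      WeierstrassCurve.Affine.Point.map ι.toRatAlgHom P = heegnerPointComplex Dt H →
      ¬ (p : ℤ) ∣ Dt.c → ¬ IsOfFinAddOrder P →
      ∀ (κ : ZpExtension K p), κ.IsAnticyclotomic →
        ∀ (γ : Field.absoluteGaloisGroup K) [Fact (κ.IsTopGenerator γ)]
          (𝔭 : HeightOneSpectrum (𝓞 K)) (h𝔭 : ((p : ℕ) : 𝓞 K) ∈ 𝔭.asIdeal)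
          (he : 𝔭.asIdeal.ramificationIdx (𝓞 ℚ) = 1) (hf : 𝔭.asIdeal.inertiaDeg (𝓞 ℚ) = 1),
          X11b.ControlOnTreeGoodAt p κ 𝔭 γ (X11b.embAt K p 𝔭 h𝔭 he hf) P)
    (hLA : ∀ (W : WeierstrassCurve ℚ) [W.IsElliptic] [W.IsGloballyMinimal] (p : ℕ) [Fact p.Prime]
      (N : ℕ) [NeZero N] (K : Type) [Field K] [NumberField K]
      (Dt : ModularParametrizationData W N) (H : HeegnerDatum N (NumberField.discr K)) (ι : K →+* ℂ)
      (P : (W.baseChange K).toAffine.Point),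
      RowC16 W p → W.analyticRank = 1 → ¬ p ∣ W.tamagawaProduct →
      W.conductorNorm ℤ = N → IsImaginaryQuadratic K → Odd (NumberField.discr K) →
      NumberField.discr K < -4 → SatisfiesHeegnerHypothesis N K → SatisfiesHeegnerHypothesis p K →
      (W.quadraticTwist (NumberField.discr K : ℚ)).entireLFunction 1 ≠ 0 →
      WeierstrassCurve.Affine.Point.map ι.toRatAlgHom P = heegnerPointComplex Dt H →
      ¬ (p : ℤ) ∣ Dt.c → ¬ IsOfFinAddOrder P →
      ∀ (κ : ZpExtension K p), κ.IsAnticyclotomic →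
        ∀ (γ : Field.absoluteGaloisGroup K) [Fact (κ.IsTopGenerator γ)]
          (𝔭 : HeightOneSpectrum (𝓞 K)) (h𝔭 : ((p : ℕ) : 𝓞 K) ∈ 𝔭.asIdeal)
          (he : 𝔭.asIdeal.ramificationIdx (𝓞 ℚ) = 1) (hf : 𝔭.asIdeal.inertiaDeg (𝓞 ℚ) = 1),
          X11b.IMCLowerWaldspurgerOnTreeGoodAt p κ 𝔭 γ (X11b.embAt K p 𝔭 h𝔭 he hf) P)
    (W : WeierstrassCurve ℚ) [W.IsElliptic] [W.IsGloballyMinimal] (p : ℕ) [Fact p.Prime]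
    (h : RowC16 W p) (hr : W.analyticRank ≤ 1)
    (htam0 : W.analyticRank = 1 → ¬ p ∣ W.tamagawaProduct) : BSDp W p := by
  rcases Nat.lt_or_ge W.analyticRank 1 with h0 | h1
  · exact RowC16.bsdp_rankZero_of_yzThm49 hYZ hW20 hGr hpar hGZK h (by omega)
  · have hr1 : W.analyticRank = 1 := le_antisymm hr h1
    exact RowC16.bsdp_rankOne_of_onTreeGoodLinks_of_yzThm49 hGZ hKo hB hYZ hW20 hGr hGZK hmod hpar
      hnf hHL hMaz hNS hLC hLA W p h hr1 (htam0 hr1)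

end Summit.BirchSwinnertonDyer.Rank1Residual

end
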